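/-
Copyright (c) 2026 the pub-hodgecm-mathlib formalisation cell (harness21).  Prover seat hodgecm-mathlib-K2E3-p05 (g0), Track B «K2-LIT»,
engine E3 «EllipticInputs», unit U4 «Keys», 2026-09-03.  KERNEL module: THEOREMS ONLY (no definition, no named fact, no `sorry`,
no instance, no notation).
-/
import Mathlib.LinearAlgebra.LinearIndependent.Lemmas
import Mathlib.LinearAlgebra.Span.Basic
import Mathlib.Analysis.Complex.Basic
import HarnessLib

/-!
# K2 ∕ E3 «EllipticInputs», unit U4 «Keys» — Road II of MEMO `hK-KeysThmTwo` (unramified first rung of [Keys1984 §7 Thm (2)]), stub II-4 in ABSTRACT form: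
# the «two maximal parahorics» reducibility criterion as pure linear algebra on the Iwahori plane `V^I = ℂ f₁ ⊕ ℂ f_w`
# [Casselman1980 §3; Borel1976 §4; Rogawski1990 §12.2 (1)(2)]

Cell hodgecm-mathlib (D-0151), FLOOR 0, Track B «K2-LIT», engine E3, crux item H413 = stmt-HodgeConjecture-24833 (route `HCCMUnconditional`, no route verbs);
SIGS-TABLE-K2E3 row #5 (U4-b), MEMO `K2/K2E3-p05/g0/MEMO-hK-KeysThmTwo.K2E3-p05-g0.md` (a135e4932fe89f8d) Road II «unramified χ via the two maximal parahorics
K ⊃ I ⊂ K′».  Author K2E3-p05 (g0).  `--supports stmt-HodgeConjecture-24833 --as helper`; THEOREMS ONLY; Mathlib-only imports (frame-free).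

THE MATHEMATICS.  Let `V = i_G(χ)` be an unramified principal series of the rank-one group `G = U(Φ₃)(L⁺_v)` (`v` inert), `I` the Iwahori subgroup, `K = I ⊔ IwI` and
`K′ = I ⊔ Iw′I` the two maximal parahorics containing it.  Then `V^I = ℂ f₁ ⊕ ℂ f_w` (supports `BI`, `BwI`), `V^K = ℂ(f₁ + f_w)`, `V^{K′} = ℂ(f₁ + c·f_w)` for an explicit
`c = c(χ)`, and the averaging projectors `P_K`, `P_{K′}` (idempotents of the Hecke algebra; they preserve every `G`-stable subspace) act on the Iwahori plane through two
linear forms, `P_K(x f₁ + y f_w) = (a₀x + b₀y)·e₀`, `P_{K′}(x f₁ + y f_w) = (a₁x + b₁y)·e₁` (`e₀`, `e₁` spherical vectors; `a₀ : b₀ = 1 : [IwI : I]`, and `(a₁, b₁)` is THE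
rank-one cell computation of stub II-2).  If `N` is a `G`-stable subspace whose Iwahori-fixed part `N ∩ V^I` is a LINE `ℂu` (stub II-3: `0 ≠ N ≠ V` forces this), the four
possibilities for `(N ∩ V^K, N ∩ V^{K′}) ∈ {0, line}²` each impose ONE algebraic condition: `(0,0)`: `u` is killed by both forms ⇒ `a₀b₁ − b₀a₁ = 0`; `(≠0,≠0)`: both
spherical vectors lie on the line `ℂu` ⇒ `c = 1`; `(≠0,0)`: `u ∝ f₁ + f_w` killed by the `K′`-form ⇒ `a₁ + b₁ = 0`; `(0,≠0)`: `u ∝ f₁ + c f_w` killed by the `K`-form ⇒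
`a₀ + b₀c = 0`.  With the explicit `a₀, b₀, a₁, b₁, c` (functions of `z = χ₁(ϖ)` and the indices `[IwI:I] = q³`, `[Iw′I:I] = q` at an inert `v`) these four equations cut
out `z ∈ {q_E^{±1}} ∪ {−q_F^{±1}} ∪ {unitary}` = Keys' cases (a)(c) [Rogawski1990 §12.2 (1)(2) with `η = η₀` unramified] — stub II-4's assembly.  THIS FILE is the
group-free core: §1 `criterion_of_iwahoriLine` over an arbitrary `ℂ`-module `V`, a submodule `N` stable under two endomorphisms `P₀`, `P₁`, linearly independent `f₁, f_w`,
and the line hypothesis on `N ⊓ span{f₁, f_w}`.  No representation theory is used or restated; the dischargers (II-1 the vectors, II-2 the forms, II-3 the line) are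
separate files over ★ `F0P3cStCharTSPSLevels` ∕ `…PSLevelsCells` (dims `(1,1,2)`), ★ Mackey, ★ Iwasawa.
HONEST LABEL: HC_CM is proved only modulo the 7 printed citations (2 remaining named inputs: hLiu418 = stmt-HodgeConjecture-24832, h413 = stmt-HodgeConjecture-24833)
until rung 0 closes; count-neutral (linear algebra; no printed citation is discharged).

## References
* [Casselman1980] W. Casselman, *The unramified principal series of p-adic groups I. The spherical function*, Compositio Math. 40 (1980), §3 (the projections onto
  parahoric-fixed vectors on the Iwahori-fixed space).
* [Borel1976] A. Borel, *Admissible representations of a semi-simple group over a local field with vectors fixed under an Iwahori subgroup*, Invent. Math. 35 (1976), §4.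
* [Rogawski1990] J. D. Rogawski, Ann. of Math. Stud. 123 (1990), §12.2 (1)(2) p. 173.  * [Keys1984] D. Keys, Compositio Math. 51 (1984), §7 Thm (2) (a)(c).
-/

set_option autoImplicit false
-- the mandated namespace has the single-problem summit's repeated segment (`HodgeConjecture.HodgeConjecture`)
set_option linter.dupNamespace false

noncomputable section

namespace Summit.HodgeConjecture.HodgeConjecture.Cruxes.H413.K2E3ParahoricReducibilityCriterion

variable {V : Type*} [AddCommGroup V] [Module ℂ V]

/-! ## §0 Two small facts on the plane `ℂ f₁ ⊕ ℂ f_w` -/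

/-- Coordinates on the Iwahori plane: a member of `span {f₁, f_w}` is `x f₁ + y f_w`. [folklore] -/
theorem exists_coords_of_mem_span_pair (f₁ f_w : V) {u : V} (hu : u ∈ Submodule.span ℂ ({f₁, f_w} : Set V)) :
    ∃ x y : ℂ, u = x • f₁ + y • f_w := by
  rw [Submodule.mem_span_pair] at hu
  obtain ⟨x, y, rfl⟩ := hu
  exact ⟨x, y, rfl⟩

/-- Uniqueness of coordinates for linearly independent `f₁, f_w`: `x f₁ + y f_w = x′ f₁ + y′ f_w ⇒ x = x′ ∧ y = y′`. [folklore] -/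
theorem coords_unique {f₁ f_w : V} (hlin : LinearIndependent ℂ ![f₁, f_w]) {x y x' y' : ℂ}
    (h : x • f₁ + y • f_w = x' • f₁ + y' • f_w) : x = x' ∧ y = y' := by
  have h0 : (x - x') • f₁ + (y - y') • f_w = 0 := by
    rw [sub_smul, sub_smul]
    have := sub_eq_zero.2 h
    rw [← this]
    abel
  have hpair := LinearIndependent.pair_iff.1 hlin (x - x') (y - y') h0
  exact ⟨sub_eq_zero.1 hpair.1, sub_eq_zero.1 hpair.2⟩

/-! ## §1 The criterion -/

/-- **The «two maximal parahorics» criterion on the Iwahori plane, abstract form.**  Data: linearly independent `f₁, f_w ∈ V` (the Iwahori basis); a scalar `c`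
(the `K′`-spherical vector is `f₁ + c f_w`, the `K`-spherical one `f₁ + f_w`); endomorphisms `P₀, P₁` of `V` (the parahoric averages) preserving the subspace `N` with
`P₀ V ⊆ ℂ(f₁ + f_w)`, `P₁ V ⊆ ℂ(f₁ + c f_w)`, acting on the plane through the linear forms `(a₀, b₀)`, `(a₁, b₁)` against non-zero vectors `e₀, e₁`; and the LINE hypothesis:
`N ⊓ span{f₁, f_w} = ℂu` for some `u ≠ 0`.  Conclusion: `a₀b₁ − b₀a₁ = 0 ∨ c = 1 ∨ a₁ + b₁ = 0 ∨ a₀ + b₀c = 0` — one equation per case of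
`(N ⊓ ℂ(f₁+f_w), N ⊓ ℂ(f₁+cf_w)) ∈ {0, ≠0}²`. [cite: Casselman1980, §3] [cite: Borel1976, §4] -/
theorem criterion_of_iwahoriLine (N : Submodule ℂ V) (f₁ f_w e₀ e₁ : V) (hlin : LinearIndependent ℂ ![f₁, f_w])
    (he₀ : e₀ ≠ 0) (he₁ : e₁ ≠ 0) (c a₀ b₀ a₁ b₁ : ℂ)
    (P₀ P₁ : V →ₗ[ℂ] V) (hP₀N : ∀ x ∈ N, P₀ x ∈ N) (hP₁N : ∀ x ∈ N, P₁ x ∈ N)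
    (hP₀W : ∀ x, P₀ x ∈ Submodule.span ℂ ({f₁ + f_w} : Set V)) (hP₁W : ∀ x, P₁ x ∈ Submodule.span ℂ ({f₁ + c • f_w} : Set V))
    (hP₀f : ∀ x y : ℂ, P₀ (x • f₁ + y • f_w) = (a₀ * x + b₀ * y) • e₀)
    (hP₁f : ∀ x y : ℂ, P₁ (x • f₁ + y • f_w) = (a₁ * x + b₁ * y) • e₁)
    (u : V) (hu0 : u ≠ 0) (huN : u ∈ N) (huI : u ∈ Submodule.span ℂ ({f₁, f_w} : Set V))
    (hline : ∀ u' ∈ N, u' ∈ Submodule.span ℂ ({f₁, f_w} : Set V) → ∃ t : ℂ, u' = t • u) :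
    a₀ * b₁ - b₀ * a₁ = 0 ∨ c = 1 ∨ a₁ + b₁ = 0 ∨ a₀ + b₀ * c = 0 := by
  obtain ⟨x, y, hxy⟩ := exists_coords_of_mem_span_pair f₁ f_w huI
  have hxy0 : ¬(x = 0 ∧ y = 0) := by
    rintro ⟨rfl, rfl⟩
    apply hu0
    rw [hxy, zero_smul, zero_smul, add_zero]
  -- the two spherical vectors lie on the plane
  have hf₀I : f₁ + f_w ∈ Submodule.span ℂ ({f₁, f_w} : Set V) :=
    Submodule.add_mem _ (Submodule.subset_span (by simp)) (Submodule.subset_span (by simp))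
  have hf₀'I : f₁ + c • f_w ∈ Submodule.span ℂ ({f₁, f_w} : Set V) :=
    Submodule.add_mem _ (Submodule.subset_span (by simp)) (Submodule.smul_mem _ _ (Submodule.subset_span (by simp)))
  -- (K) either `P₀ u = 0` (no `K`-fixed vector in `N`) or `f₁ + f_w ∈ ℂu`
  have hK : a₀ * x + b₀ * y = 0 ∨ ∃ t : ℂ, f₁ + f_w = t • u := by
    by_cases h : P₀ u = 0
    · left
      rw [hxy, hP₀f] at h
      exact (smul_eq_zero.1 h).resolve_right he₀
    · right
      -- `P₀ u` is a non-zero multiple of `f₁ + f_w` inside `N`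
      have hmem : P₀ u ∈ N := hP₀N u huN
      obtain ⟨s, hs⟩ := Submodule.mem_span_singleton.1 (hP₀W u)
      have hs0 : s ≠ 0 := fun h0 => h (by rw [← hs, h0, zero_smul])
      have hf₀N : f₁ + f_w ∈ N := by
        have : f₁ + f_w = s⁻¹ • P₀ u := by rw [← hs, smul_smul, inv_mul_cancel₀ hs0, one_smul]
        rw [this]; exact N.smul_mem _ hmem
      exact hline _ hf₀N hf₀I
  -- (K′) either `P₁ u = 0` or `f₁ + c f_w ∈ ℂu`
  have hK' : a₁ * x + b₁ * y = 0 ∨ ∃ t : ℂ, f₁ + c • f_w = t • u := by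
    by_cases h : P₁ u = 0
    · left
      rw [hxy, hP₁f] at h
      exact (smul_eq_zero.1 h).resolve_right he₁
    · right
      have hmem : P₁ u ∈ N := hP₁N u huN
      obtain ⟨s, hs⟩ := Submodule.mem_span_singleton.1 (hP₁W u)
      have hs0 : s ≠ 0 := fun h0 => h (by rw [← hs, h0, zero_smul])
      have hf₀'N : f₁ + c • f_w ∈ N := by
        have : f₁ + c • f_w = s⁻¹ • P₁ u := by rw [← hs, smul_smul, inv_mul_cancel₀ hs0, one_smul]
        rw [this]; exact N.smul_mem _ hmem
      exact hline _ hf₀'N hf₀'I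
  -- reading `f₁ + f_w = t • u` ∕ `f₁ + c f_w = t • u` in coordinates
  have hread₀ : ∀ t : ℂ, f₁ + f_w = t • u → t * x = 1 ∧ t * y = 1 := by
    intro t ht
    rw [hxy, smul_add, smul_smul, smul_smul] at ht
    have h1 : (1 : ℂ) • f₁ + (1 : ℂ) • f_w = (t * x) • f₁ + (t * y) • f_w := by rw [one_smul, one_smul]; exact ht
    obtain ⟨h1x, h1y⟩ := coords_unique hlin h1
    exact ⟨h1x.symm, h1y.symm⟩
  have hread₁ : ∀ t : ℂ, f₁ + c • f_w = t • u → t * x = 1 ∧ t * y = c := by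
    intro t ht
    rw [hxy, smul_add, smul_smul, smul_smul] at ht
    have h1 : (1 : ℂ) • f₁ + c • f_w = (t * x) • f₁ + (t * y) • f_w := by rw [one_smul]; exact ht
    obtain ⟨h1x, h1y⟩ := coords_unique hlin h1
    exact ⟨h1x.symm, h1y.symm⟩
  rcases hK with h₀ | ⟨t₀, ht₀⟩ <;> rcases hK' with h₁ | ⟨t₁, ht₁⟩
  · -- (0,0): `(x, y) ≠ 0` solves both forms ⇒ the determinant vanishes
    left
    by_cases hx : x = 0
    · have hy : y ≠ 0 := fun hy => hxy0 ⟨hx, hy⟩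
      rw [hx, mul_zero, zero_add] at h₀ h₁
      have hb₀ : b₀ = 0 := (mul_eq_zero.1 h₀).resolve_right hy
      have hb₁ : b₁ = 0 := (mul_eq_zero.1 h₁).resolve_right hy
      rw [hb₀, hb₁, mul_zero, zero_mul, sub_zero]
    · have e₁' : a₀ = -(b₀ * y) / x := by field_simp; linear_combination h₀
      have e₂' : a₁ = -(b₁ * y) / x := by field_simp; linear_combination h₁
      rw [e₁', e₂']
      field_simp
      ring
  · -- (0, ≠0): `u ∝ f₁ + c f_w` killed by the `K`-form
    right; right; right
    obtain ⟨hx1, hyc⟩ := hread₁ t₁ ht₁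
    have ht0 : t₁ ≠ 0 := by rintro rfl; simp at hx1
    have hx' : x = t₁⁻¹ := by field_simp; linear_combination hx1
    have hy' : y = c * t₁⁻¹ := by field_simp; linear_combination hyc
    rw [hx', hy'] at h₀
    field_simp at h₀
    linear_combination h₀
  · -- (≠0, 0): `u ∝ f₁ + f_w` killed by the `K′`-form
    right; right; left
    obtain ⟨hx1, hy1⟩ := hread₀ t₀ ht₀
    have ht0 : t₀ ≠ 0 := by rintro rfl; simp at hx1
    have hx' : x = t₀⁻¹ := by field_simp; linear_combination hx1
    have hy' : y = t₀⁻¹ := by field_simp; linear_combination hy1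
    rw [hx', hy'] at h₁
    field_simp at h₁
    linear_combination h₁
  · -- (≠0, ≠0): both spherical vectors on the line `ℂu` ⇒ `c = 1`
    right; left
    obtain ⟨hx0, hy0⟩ := hread₀ t₀ ht₀
    obtain ⟨hx1, hyc⟩ := hread₁ t₁ ht₁
    have ht : t₀ = t₁ := by
      have hxne : x ≠ 0 := by rintro rfl; simp at hx0
      exact mul_right_cancel₀ hxne (hx0.trans hx1.symm)
    rw [← hyc, ← ht, hy0]

end Summit.HodgeConjecture.HodgeConjecture.Cruxes.H413.K2E3ParahoricReducibilityCriterion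

end
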